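import Literature.Analysis.FunctionSpaces.TorusEnstrophyTrilinear
import Literature.Analysis.FunctionSpaces.TorusSobolevSup
import Literature.Analysis.FunctionSpaces.TorusTrilinearH1
import HarnessLib

/-!
# The `H¹` norm of the inertial term `(u·∇)u` by the `H²` norm on `T³`

Analysis/FunctionSpaces support file (everything proved; no definitions, no named facts), sequel of
`TorusEnstrophyTrilinear.lean` (`∫ |∇u|⁴ ≤ K ‖∇u‖₂ ‖Δu‖₂³`, `∑ₘ ‖∇∂ₘu‖₂² = ‖Δu‖₂²`),
`TorusSobolevSup.lean` (`H²(T³) ⊂ L^∞(T³)`) and `TorusTrilinearH1.lean` (Poincaré–Wirtinger in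
`L²`). It proves the estimate of the gradient of the convective term that drives the `H²`
(second-order) energy estimate of the space-periodic Navier–Stokes equations — the torus form of
"`B` maps `D(A) × D(A)` boundedly into `V`" (the `H¹`-level instance of "`H²(T³)` is an algebra"
used in Robinson–Rodrigo–Sadowski 2016, proof of Thm 7.1; by Hölder, Ladyzhenskaya (A.27) and
the sup-norm embedding, cf. Foias–Manley–Rosa–Temam 2001, Ch. II App. A, Constantin–Foias 1988,
Ch. 6):

* `Torus.partialDeriv_convect_self_eq_add` — the Leibniz rule
  `∂ₘ((u·∇)u) = (u·∇)∂ₘu + (∂ₘu·∇)u` (from `Torus.partialDeriv_convect_self` and Schwarz);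
* `Torus.sum_norm_convect_partialDeriv_sq_le` — pointwise, `∑ₘ ‖(∂ₘu·∇)u‖² ≤ d |∇u|⁴`,
  `|∇u|² = ∑ₘ ‖∂ₘu‖²`;
* `Torus.sum_norm_convect_sq_le_of_norm_le` — pointwise, `∑ₘ ‖(u·∇)∂ₘu‖² ≤ d M² ∑ₘ∑ᵢ ‖∂ᵢ∂ₘu‖²`
  when `‖u‖ ≤ M`;
* `Torus.abs_sum_integral_inner_partialDeriv_le` — Young's inequality for gradient pairings,
  `|∑ᵢ ∫ ⟪∂ᵢa, ∂ᵢw⟫| ≤ (ε/2)‖∇a‖₂² + (2ε)⁻¹‖∇w‖₂²`;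
* `Torus.gradNormSq_convect_self_le_of_norm_le` — in every dimension,
  `‖∇((u·∇)u)‖₂² ≤ 2d M² ‖Δu‖₂² + 2d ∫ |∇u|⁴` when `‖u‖ ≤ M` on `T^d`;
* `Torus.norm_sq_le_gradNormSq_add_of_hasZeroMean` — on `T³`, `‖u(x)‖² ≤ K (‖∇u‖₂² + ‖Δu‖₂²)`
  for smooth zero-mean `u` (the sup-norm embedding of `TorusSobolevSup` with Poincaré–Wirtinger
  and `∑ᵢ∑ⱼ ∫ ‖∂ᵢ∂ⱼu‖² = ‖Δu‖₂²`);
* `Torus.gradNormSq_convect_self_le` — **the estimate**: on `T^d` with `card d = 3` there is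
  `C ≥ 0` with `‖∇((u·∇)u)‖₂² ≤ C (‖∇u‖₂² + ‖Δu‖₂²) ‖Δu‖₂²` for every smooth zero-mean
  `u : T^d → ℝ^d` (`‖∇·‖₂² = Torus.gradNormSq`, `‖Δu‖₂² = ∫ ‖Torus.laplacian u‖²`).

Zero mean is essential (a Galilean boost `u ↦ u + V` changes `(u·∇)u` by `(V·∇)u`); it enters
only through the sup-norm of `u`. Constants are existential. Consumed by the `H²` smoothing
estimate of classical Navier–Stokes solutions (`FluidPDE/TorusClassicalNSH2Smoothing.lean`).

## Mathlib / tree search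

Tree (reused): `Torus.partialDeriv_convect_self`, `Torus.convect_eq_sum_smul_partialDeriv`,
`Torus.partialDeriv_comm` (`TorusEnstrophyOrthogonality`), `Torus.norm_convect_le`
(`TorusFourierModes`), `Torus.integral_sum_norm_sq_partialDeriv_sq_le`,
`Torus.sum_gradNormSq_partialDeriv_eq` (`TorusEnstrophyTrilinear`),
`Torus.norm_sq_le_sobolev_two_of_isSmooth` (`TorusSobolevSup`),
`Torus.integral_norm_sq_le_card_pow_mul_gradNormSq` (`TorusTrilinearH1`); Mathlib
`sq_sum_le_card_mul_sum_sq`. Searched `gradNormSq (convect`, `gradNormSq_convect`,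
`norm_sq_le_gradNormSq`: no `H¹` bound of the inertial term on the torus (the pointwise bounds
`Torus.norm_convect_sq_le_of_norm_le` of `TorusClassicalNSDifferenceBalances` assume `L^∞`
coefficients and are not imported here).

## References

* P. Constantin, C. Foias, *Navier–Stokes Equations*, Univ. Chicago Press 1988, Ch. 6,
  Prop. 6.1 (inequalities for the trilinear form, `n = 3`). [ConstantinFoiasNSE1988]
* C. Foias, O. Manley, R. Rosa, R. Temam, *Navier–Stokes Equations and Turbulence*, CUP 2001,
  Ch. II App. A, (A.27), (A.29). [FoiasManleyRosaTemam2001]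
* J. C. Robinson, J. L. Rodrigo, W. Sadowski, *The Three-Dimensional Navier–Stokes Equations*,
  CUP 2016, proof of Thm 7.1 (`H^k` is an algebra, `k ≥ 2`). [RobinsonRodrigoSadowskiCUP2016]
-/

noncomputable section

open _root_.MeasureTheory Set Filter Function
open scoped ENNReal NNReal InnerProductSpace ContDiff

namespace Literature.Analysis.FunctionSpaces

namespace Torus

variable {d : Type*} [Fintype d] [DecidableEq d]

/-! ### Pointwise algebra -/

/-- **Leibniz rule for the inertial term**: `∂ₘ((u·∇)u) = (u·∇)∂ₘu + (∂ₘu·∇)u` pointwise for a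
smooth field (`Torus.partialDeriv_convect_self` and `∂ₘ∂ᵢ = ∂ᵢ∂ₘ`). [folklore] -/
theorem partialDeriv_convect_self_eq_add {u : UnitAddTorus d → EuclideanSpace ℝ d}
    (hu : IsSmooth u) (m : d) (x : UnitAddTorus d) :
    partialDeriv m (convect u u) x = convect u (partialDeriv m u) x + convect (partialDeriv m u) u x := by
  have hu1 : IsContDiff 1 u := hu.isContDiff (by simp)
  have hD1 : IsContDiff 1 (partialDeriv m u) := (hu.partialDeriv m).isContDiff (by simp)
  rw [partialDeriv_convect_self hu m x, Finset.sum_add_distrib,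
    convect_eq_sum_smul_partialDeriv hD1 x, convect_eq_sum_smul_partialDeriv hu1 x]
  congr 1
  refine Finset.sum_congr rfl fun i _ => ?_
  rw [partialDeriv_comm hu m i x]

/-- **The stretching part, pointwise**: `∑ₘ ‖(∂ₘu·∇)u‖² ≤ d (∑ₘ ‖∂ₘu‖²)²`
(`‖(v·∇)u‖ ≤ ‖v‖ ∑ᵢ ‖∂ᵢu‖`, `Torus.norm_convect_le`, and `(∑ᵢ aᵢ)² ≤ d ∑ᵢ aᵢ²`). [folklore] -/
theorem sum_norm_convect_partialDeriv_sq_le {u : UnitAddTorus d → EuclideanSpace ℝ d}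
    (hu : IsSmooth u) (x : UnitAddTorus d) :
    ∑ m, ‖convect (partialDeriv m u) u x‖ ^ 2 ≤
      Fintype.card d * (∑ m, ‖partialDeriv m u x‖ ^ 2) ^ 2 := by
  have hu1 : IsContDiff 1 u := hu.isContDiff (by simp)
  set θ : ℝ := ∑ m, ‖partialDeriv m u x‖ ^ 2 with hθ
  have hθ0 : 0 ≤ θ := Finset.sum_nonneg fun m _ => sq_nonneg _
  set L : ℝ := ∑ i, ‖partialDeriv i u x‖ with hL
  have hL0 : 0 ≤ L := Finset.sum_nonneg fun i _ => norm_nonneg _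
  have hL2 : L ^ 2 ≤ Fintype.card d * θ := by
    have h := sq_sum_le_card_mul_sum_sq (s := Finset.univ) (f := fun i => ‖partialDeriv i u x‖)
    rwa [Finset.card_univ] at h
  have hterm : ∀ m, ‖convect (partialDeriv m u) u x‖ ^ 2 ≤ ‖partialDeriv m u x‖ ^ 2 * L ^ 2 := by
    intro m
    have h := norm_convect_le (partialDeriv m u) hu1 x
    calc ‖convect (partialDeriv m u) u x‖ ^ 2 ≤ (‖partialDeriv m u x‖ * L) ^ 2 :=
          pow_le_pow_left₀ (norm_nonneg _) h 2
      _ = ‖partialDeriv m u x‖ ^ 2 * L ^ 2 := by ring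
  calc ∑ m, ‖convect (partialDeriv m u) u x‖ ^ 2 ≤ ∑ m, ‖partialDeriv m u x‖ ^ 2 * L ^ 2 :=
        Finset.sum_le_sum fun m _ => hterm m
    _ = θ * L ^ 2 := by rw [← Finset.sum_mul]
    _ ≤ θ * (Fintype.card d * θ) := mul_le_mul_of_nonneg_left hL2 hθ0
    _ = Fintype.card d * θ ^ 2 := by ring

/-- **The transport part, pointwise**: `∑ₘ ‖(u·∇)∂ₘu‖² ≤ d M² ∑ₘ ∑ᵢ ‖∂ᵢ∂ₘu‖²` when `‖u(x)‖ ≤ M`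
(`‖(u·∇)w‖ ≤ ‖u‖ ∑ᵢ ‖∂ᵢw‖` and Cauchy–Schwarz in `i`). [folklore] -/
theorem sum_norm_convect_sq_le_of_norm_le {u : UnitAddTorus d → EuclideanSpace ℝ d}
    (hu : IsSmooth u) {M : ℝ} {x : UnitAddTorus d} (hM : ‖u x‖ ≤ M) :
    ∑ m, ‖convect u (partialDeriv m u) x‖ ^ 2 ≤
      Fintype.card d * M ^ 2 * ∑ m, ∑ i, ‖partialDeriv i (partialDeriv m u) x‖ ^ 2 := by
  have hM0 : 0 ≤ M := (norm_nonneg _).trans hM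
  have hterm : ∀ m, ‖convect u (partialDeriv m u) x‖ ^ 2 ≤
      Fintype.card d * M ^ 2 * ∑ i, ‖partialDeriv i (partialDeriv m u) x‖ ^ 2 := by
    intro m
    have hD1 : IsContDiff 1 (partialDeriv m u) := (hu.partialDeriv m).isContDiff (by simp)
    set L : ℝ := ∑ i, ‖partialDeriv i (partialDeriv m u) x‖ with hL
    have hL0 : 0 ≤ L := Finset.sum_nonneg fun i _ => norm_nonneg _
    have hL2 : L ^ 2 ≤ Fintype.card d * ∑ i, ‖partialDeriv i (partialDeriv m u) x‖ ^ 2 := by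
      have h := sq_sum_le_card_mul_sum_sq (s := Finset.univ)
        (f := fun i => ‖partialDeriv i (partialDeriv m u) x‖)
      rwa [Finset.card_univ] at h
    have h := norm_convect_le u hD1 x
    calc ‖convect u (partialDeriv m u) x‖ ^ 2 ≤ (‖u x‖ * L) ^ 2 :=
          pow_le_pow_left₀ (norm_nonneg _) h 2
      _ ≤ (M * L) ^ 2 := pow_le_pow_left₀ (mul_nonneg (norm_nonneg _) hL0)
          (mul_le_mul_of_nonneg_right hM hL0) 2
      _ = M ^ 2 * L ^ 2 := by ring
      _ ≤ M ^ 2 * (Fintype.card d * ∑ i, ‖partialDeriv i (partialDeriv m u) x‖ ^ 2) :=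
          mul_le_mul_of_nonneg_left hL2 (sq_nonneg _)
      _ = Fintype.card d * M ^ 2 * ∑ i, ‖partialDeriv i (partialDeriv m u) x‖ ^ 2 := by ring
  calc ∑ m, ‖convect u (partialDeriv m u) x‖ ^ 2
      ≤ ∑ m, Fintype.card d * M ^ 2 * ∑ i, ‖partialDeriv i (partialDeriv m u) x‖ ^ 2 :=
        Finset.sum_le_sum fun m _ => hterm m
    _ = Fintype.card d * M ^ 2 * ∑ m, ∑ i, ‖partialDeriv i (partialDeriv m u) x‖ ^ 2 := by
        rw [Finset.mul_sum]

/-! ### Young's inequality for gradient pairings -/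

/-- **`|∑ᵢ ∫ ⟪∂ᵢa, ∂ᵢw⟫| ≤ (ε/2) ‖∇a‖₂² + (2ε)⁻¹ ‖∇w‖₂²`** for smooth fields on `T^d` and `ε > 0`
(pointwise `|⟪p, q⟫| ≤ ‖p‖‖q‖ ≤ (ε/2)‖p‖² + (2ε)⁻¹‖q‖²`, summed and integrated; with Green's first
identity this is Young's inequality for `∫ ⟪a, Δw⟫`). [folklore] -/
theorem abs_sum_integral_inner_partialDeriv_le {a w : UnitAddTorus d → EuclideanSpace ℝ d}
    (ha : IsSmooth a) (hw : IsSmooth w) {ε : ℝ} (hε : 0 < ε) :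
    |∑ i, ∫ x, ⟪partialDeriv i a x, partialDeriv i w x⟫_ℝ| ≤
      ε / 2 * gradNormSq a + (2 * ε)⁻¹ * gradNormSq w := by
  have hyoung : ∀ (p q : EuclideanSpace ℝ d), |⟪p, q⟫_ℝ| ≤ ε / 2 * ‖p‖ ^ 2 + (2 * ε)⁻¹ * ‖q‖ ^ 2 := by
    intro p q
    refine (abs_real_inner_le_norm p q).trans ?_
    rw [← sub_nonneg]
    have h2 : ε / 2 * ‖p‖ ^ 2 + (2 * ε)⁻¹ * ‖q‖ ^ 2 - ‖p‖ * ‖q‖ = (ε * ‖p‖ - ‖q‖) ^ 2 / (2 * ε) := by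
      field_simp
      ring
    rw [h2]
    positivity
  have hint : ∀ i, Integrable (fun x => ⟪partialDeriv i a x, partialDeriv i w x⟫_ℝ) volume :=
    fun i => ((ha.partialDeriv i).inner (hw.partialDeriv i)).integrable
  have hia : ∀ i, Integrable (fun x => ‖partialDeriv i a x‖ ^ 2) volume :=
    fun i => ((ha.partialDeriv i).norm_sq).integrable
  have hiw : ∀ i, Integrable (fun x => ‖partialDeriv i w x‖ ^ 2) volume :=
    fun i => ((hw.partialDeriv i).norm_sq).integrable
  have hterm : ∀ i, |∫ x, ⟪partialDeriv i a x, partialDeriv i w x⟫_ℝ| ≤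
      ε / 2 * (∫ x, ‖partialDeriv i a x‖ ^ 2) + (2 * ε)⁻¹ * ∫ x, ‖partialDeriv i w x‖ ^ 2 := by
    intro i
    rw [← integral_const_mul, ← integral_const_mul, ← integral_add ((hia i).const_mul _) ((hiw i).const_mul _)]
    refine abs_integral_le_integral_abs.trans (integral_mono (hint i).abs
      (((hia i).const_mul _).add ((hiw i).const_mul _)) fun x => hyoung _ _)
  have hEa : gradNormSq a = ∑ i, ∫ x, ‖partialDeriv i a x‖ ^ 2 := by
    rw [gradNormSq, integral_finsetSum _ fun i _ => hia i]
  have hEw : gradNormSq w = ∑ i, ∫ x, ‖partialDeriv i w x‖ ^ 2 := by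
    rw [gradNormSq, integral_finsetSum _ fun i _ => hiw i]
  rw [hEa, hEw, Finset.mul_sum, Finset.mul_sum, ← Finset.sum_add_distrib]
  exact (Finset.abs_sum_le_sum_abs _ _).trans (Finset.sum_le_sum fun i _ => hterm i)

/-! ### The `L²` gradient of the inertial term -/

/-- `∫ ∑ₘ ∑ᵢ ‖∂ᵢ∂ₘu‖² = ‖Δu‖₂²` (the `L²` norm of the Hessian equals that of the Laplacian on the
flat torus, `Torus.sum_gradNormSq_partialDeriv_eq`, with the sum pulled out of the integral). [folklore] -/
theorem integral_sum_sum_norm_partialDeriv_partialDeriv_sq_eq {u : UnitAddTorus d → EuclideanSpace ℝ d}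
    (hu : IsSmooth u) :
    ∫ x, ∑ m, ∑ i, ‖partialDeriv i (partialDeriv m u) x‖ ^ 2 = ∫ x, ‖laplacian u x‖ ^ 2 := by
  have hDD : ∀ i m, IsSmooth (partialDeriv i (partialDeriv m u)) := fun i m =>
    (hu.partialDeriv m).partialDeriv i
  have hint : ∀ m, Integrable (fun x => ∑ i, ‖partialDeriv i (partialDeriv m u) x‖ ^ 2) volume :=
    fun m => integrable_finsetSum _ fun i _ => ((hDD i m).norm_sq).integrable
  rw [integral_finsetSum _ fun m _ => hint m, ← sum_gradNormSq_partialDeriv_eq hu]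
  rfl

/-- **`‖∇((u·∇)u)‖₂² ≤ 2d M² ‖Δu‖₂² + 2d ∫ |∇u|⁴`** for a smooth field with `‖u‖ ≤ M` on `T^d`
(every dimension): Leibniz, `‖a + b‖² ≤ 2‖a‖² + 2‖b‖²`, the two pointwise bounds, and
`∫ ∑ₘ∑ᵢ ‖∂ᵢ∂ₘu‖² = ‖Δu‖₂²`. [folklore] -/
theorem gradNormSq_convect_self_le_of_norm_le {u : UnitAddTorus d → EuclideanSpace ℝ d}
    (hu : IsSmooth u) {M : ℝ} (hM : ∀ x, ‖u x‖ ≤ M) :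
    gradNormSq (convect u u) ≤ 2 * (Fintype.card d * M ^ 2) * (∫ x, ‖laplacian u x‖ ^ 2) +
      2 * Fintype.card d * ∫ x, (∑ m, ‖partialDeriv m u x‖ ^ 2) ^ 2 := by
  have hB : IsSmooth (convect u u) := hu.convect hu
  have hDD : ∀ i m, IsSmooth (partialDeriv i (partialDeriv m u)) := fun i m =>
    (hu.partialDeriv m).partialDeriv i
  set H : UnitAddTorus d → ℝ := fun x => ∑ m, ∑ i, ‖partialDeriv i (partialDeriv m u) x‖ ^ 2 with hH
  set θ : UnitAddTorus d → ℝ := fun x => ∑ m, ‖partialDeriv m u x‖ ^ 2 with hθ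
  have hHi : Integrable H volume :=
    integrable_finsetSum _ fun m _ => integrable_finsetSum _ fun i _ => ((hDD i m).norm_sq).integrable
  have hθs : IsSmooth θ := isSmooth_sum_norm_sq_partialDeriv hu
  have hθ2i : Integrable (fun x => θ x ^ 2) volume := by
    have hc : Continuous fun x => θ x ^ 2 := hθs.continuous.pow 2
    exact hc.integrable_unitAddTorus
  -- pointwise bound of the density of `gradNormSq (convect u u)`
  have hsq : ∀ p q : EuclideanSpace ℝ d, ‖p + q‖ ^ 2 ≤ 2 * ‖p‖ ^ 2 + 2 * ‖q‖ ^ 2 := fun p q => by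
    have h := norm_add_le p q
    nlinarith [norm_nonneg (p + q), norm_nonneg p, norm_nonneg q, sq_nonneg (‖p‖ - ‖q‖)]
  have hpt : ∀ x, ∑ m, ‖partialDeriv m (convect u u) x‖ ^ 2 ≤
      2 * (Fintype.card d * M ^ 2) * H x + 2 * Fintype.card d * θ x ^ 2 := by
    intro x
    have h1 := sum_norm_convect_sq_le_of_norm_le hu (hM x)
    have h2 := sum_norm_convect_partialDeriv_sq_le hu x
    calc ∑ m, ‖partialDeriv m (convect u u) x‖ ^ 2
        = ∑ m, ‖convect u (partialDeriv m u) x + convect (partialDeriv m u) u x‖ ^ 2 := by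
          refine Finset.sum_congr rfl fun m _ => ?_
          rw [partialDeriv_convect_self_eq_add hu m x]
      _ ≤ ∑ m, (2 * ‖convect u (partialDeriv m u) x‖ ^ 2 + 2 * ‖convect (partialDeriv m u) u x‖ ^ 2) :=
          Finset.sum_le_sum fun m _ => hsq _ _
      _ = 2 * ∑ m, ‖convect u (partialDeriv m u) x‖ ^ 2 + 2 * ∑ m, ‖convect (partialDeriv m u) u x‖ ^ 2 := by
          rw [Finset.sum_add_distrib, Finset.mul_sum, Finset.mul_sum]
      _ ≤ 2 * (Fintype.card d * M ^ 2 * H x) + 2 * (Fintype.card d * θ x ^ 2) := by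
          gcongr
      _ = 2 * (Fintype.card d * M ^ 2) * H x + 2 * Fintype.card d * θ x ^ 2 := by ring
  have hdens : Integrable (fun x => ∑ m, ‖partialDeriv m (convect u u) x‖ ^ 2) volume :=
    integrable_finsetSum _ fun m _ => ((hB.partialDeriv m).norm_sq).integrable
  calc gradNormSq (convect u u) = ∫ x, ∑ m, ‖partialDeriv m (convect u u) x‖ ^ 2 := rfl
    _ ≤ ∫ x, (2 * (Fintype.card d * M ^ 2) * H x + 2 * Fintype.card d * θ x ^ 2) :=
        integral_mono hdens ((hHi.const_mul _).add (hθ2i.const_mul _)) hpt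
    _ = 2 * (Fintype.card d * M ^ 2) * (∫ x, H x) + 2 * Fintype.card d * ∫ x, θ x ^ 2 := by
        rw [integral_add (hHi.const_mul _) (hθ2i.const_mul _), integral_const_mul, integral_const_mul]
    _ = 2 * (Fintype.card d * M ^ 2) * (∫ x, ‖laplacian u x‖ ^ 2) +
          2 * Fintype.card d * ∫ x, (∑ m, ‖partialDeriv m u x‖ ^ 2) ^ 2 := by
        rw [hH, integral_sum_sum_norm_partialDeriv_partialDeriv_sq_eq hu]

/-! ### The sup norm by `‖∇u‖₂² + ‖Δu‖₂²` on `T³` -/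

/-- **`‖u(x)‖² ≤ K (‖∇u‖₂² + ‖Δu‖₂²)` for smooth zero-mean fields on `T³`**: the sup-norm
embedding `‖u(x)‖² ≤ K₀ (∫‖u‖² + ∑ᵢ ∫‖∂ᵢu‖² + ∑ᵢ∑ⱼ ∫‖∂ᵢ∂ⱼu‖²)`
(`Torus.norm_sq_le_sobolev_two_of_isSmooth`), Poincaré–Wirtinger `∫‖u‖² ≤ d³ ‖∇u‖₂²`
(`Torus.integral_norm_sq_le_card_pow_mul_gradNormSq`) and `∑ᵢ∑ⱼ ∫‖∂ᵢ∂ⱼu‖² = ‖Δu‖₂²`; here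
`K = 28 K₀`. (The sharper interpolation form is Agmon's inequality
`‖u‖_∞ ≤ c‖∇u‖₂^{1/2}‖Δu‖₂^{1/2}`, Foias–Manley–Rosa–Temam 2001, (A.29); not needed here.)
[folklore] -/
theorem norm_sq_le_gradNormSq_add_of_hasZeroMean (hd : Fintype.card d = 3) :
    ∃ K : ℝ, 0 < K ∧ ∀ u : UnitAddTorus d → EuclideanSpace ℝ d, IsSmooth u → HasZeroMean u → ∀ x,
      ‖u x‖ ^ 2 ≤ K * (gradNormSq u + ∫ y, ‖laplacian u y‖ ^ 2) := by
  obtain ⟨K₀, hK₀, hK⟩ := norm_sq_le_sobolev_two_of_isSmooth (F' := EuclideanSpace ℝ d) hd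
  refine ⟨28 * K₀, by positivity, fun u hu h0 x => ?_⟩
  have h := hK u hu x
  have hDD : ∀ i m, IsSmooth (partialDeriv i (partialDeriv m u)) := fun i m =>
    (hu.partialDeriv m).partialDeriv i
  set E : ℝ := gradNormSq u with hE
  set Y : ℝ := ∫ y, ‖laplacian u y‖ ^ 2 with hY
  have hE0 : 0 ≤ E := gradNormSq_nonneg u
  have hY0 : 0 ≤ Y := integral_nonneg fun y => sq_nonneg _
  -- the three Sobolev pieces in terms of `E` and `Y`
  have h1 : ∫ y, ‖u y‖ ^ 2 ≤ 27 * E := by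
    have h := integral_norm_sq_le_card_pow_mul_gradNormSq hu h0
    rw [hd] at h
    norm_num at h
    exact h
  have h2 : ∑ i, ∫ y, ‖partialDeriv i u y‖ ^ 2 = E := by
    rw [hE, gradNormSq, integral_finsetSum _ fun i _ => ((hu.partialDeriv i).norm_sq).integrable]
  have h3 : ∑ i, ∑ j, ∫ y, ‖partialDeriv i (partialDeriv j u) y‖ ^ 2 = Y := by
    rw [hY, ← sum_gradNormSq_partialDeriv_eq hu, Finset.sum_comm]
    refine Finset.sum_congr rfl fun j _ => ?_
    rw [gradNormSq, integral_finsetSum _ fun i _ => ((hDD i j).norm_sq).integrable]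
  rw [h2, h3] at h
  calc ‖u x‖ ^ 2 ≤ K₀ * ((∫ y, ‖u y‖ ^ 2) + E + Y) := h
    _ ≤ K₀ * (27 * E + E + Y) := by gcongr
    _ ≤ 28 * K₀ * (E + Y) := by nlinarith

/-! ### The estimate -/

/-- **`‖∇((u·∇)u)‖₂² ≤ C (‖∇u‖₂² + ‖Δu‖₂²) ‖Δu‖₂²` on `T³`** (the bilinear term maps
`D(A) × D(A)` boundedly into `V` for zero-mean space-periodic fields — the `H¹`-level instance of
"`H²(T³)` is an algebra", cf. Robinson–Rodrigo–Sadowski 2016, proof of Thm 7.1, and the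
trilinear inequalities of Constantin–Foias 1988, Ch. 6): on `T^d` with `card d = 3` there is
`C ≥ 0` such that for every smooth zero-mean `u : T^d → ℝ^d`,
`gradNormSq ((u·∇)u) ≤ C (gradNormSq u + ∫ ‖Δu‖²) ∫ ‖Δu‖²`.
Proof: `gradNormSq_convect_self_le_of_norm_le` with `M² = K (‖∇u‖₂² + ‖Δu‖₂²)`
(`norm_sq_le_gradNormSq_add_of_hasZeroMean`) for the transport part, and
`∫ |∇u|⁴ ≤ K₁ ‖∇u‖₂ ‖Δu‖₂³ ≤ ½K₁ (‖∇u‖₂² + ‖Δu‖₂²) ‖Δu‖₂²`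
(`Torus.integral_sum_norm_sq_partialDeriv_sq_le`) for the stretching part; `C = 6K + 3K₁`.
[folklore] -/
theorem gradNormSq_convect_self_le (hd : Fintype.card d = 3) :
    ∃ C : ℝ, 0 ≤ C ∧ ∀ u : UnitAddTorus d → EuclideanSpace ℝ d, IsSmooth u → HasZeroMean u →
      gradNormSq (convect u u) ≤ C * (gradNormSq u + ∫ x, ‖laplacian u x‖ ^ 2) *
        ∫ x, ‖laplacian u x‖ ^ 2 := by
  obtain ⟨K, hK, hsup⟩ := norm_sq_le_gradNormSq_add_of_hasZeroMean (d := d) hd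
  obtain ⟨K₁, hK₁⟩ := integral_sum_norm_sq_partialDeriv_sq_le (d := d) hd
  have hK10 : (0 : ℝ) ≤ K₁ := NNReal.coe_nonneg K₁
  refine ⟨6 * K + 3 * K₁, by positivity, fun u hu h0 => ?_⟩
  set E : ℝ := gradNormSq u with hE
  set Y : ℝ := ∫ x, ‖laplacian u x‖ ^ 2 with hY
  have hE0 : 0 ≤ E := gradNormSq_nonneg u
  have hY0 : 0 ≤ Y := integral_nonneg fun x => sq_nonneg _
  -- the sup bound `‖u‖² ≤ K (E + Y)` as `‖u‖ ≤ M`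
  set M : ℝ := Real.sqrt (K * (E + Y)) with hM
  have hM2 : M ^ 2 = K * (E + Y) := Real.sq_sqrt (by positivity)
  have hMx : ∀ x, ‖u x‖ ≤ M := fun x => by
    rw [hM, ← Real.sqrt_sq (norm_nonneg (u x))]
    exact Real.sqrt_le_sqrt (hsup u hu h0 x)
  have hmain := gradNormSq_convect_self_le_of_norm_le hu hMx
  -- the stretching part: `∫ |∇u|⁴ ≤ K₁ E^{1/2} Y^{3/2} ≤ ½ K₁ (E + Y) Y`
  have h4 : ∫ x, (∑ m, ‖partialDeriv m u x‖ ^ 2) ^ 2 ≤ K₁ / 2 * ((E + Y) * Y) := by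
    have h := hK₁ u hu
    set e : ℝ := E ^ (1 / 2 : ℝ) with he
    set s : ℝ := Y ^ (1 / 2 : ℝ) with hs
    have he0 : 0 ≤ e := Real.rpow_nonneg hE0 _
    have hs0 : 0 ≤ s := Real.rpow_nonneg hY0 _
    have he2 : E = e ^ 2 := by
      rw [he, ← Real.rpow_natCast, ← Real.rpow_mul hE0]; norm_num
    have hs2 : Y = s ^ 2 := by
      rw [hs, ← Real.rpow_natCast, ← Real.rpow_mul hY0]; norm_num
    have hs3 : Y ^ (3 / 2 : ℝ) = s ^ 3 := by
      rw [hs, ← Real.rpow_natCast, ← Real.rpow_mul hY0]; norm_num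
    rw [hs3] at h
    have hes : e * s ^ 3 ≤ (e ^ 2 + s ^ 2) * s ^ 2 / 2 := by
      nlinarith [mul_nonneg (sq_nonneg (e - s)) (sq_nonneg s)]
    calc ∫ x, (∑ m, ‖partialDeriv m u x‖ ^ 2) ^ 2 ≤ K₁ * e * s ^ 3 := h
      _ = K₁ * (e * s ^ 3) := by ring
      _ ≤ K₁ * ((e ^ 2 + s ^ 2) * s ^ 2 / 2) := mul_le_mul_of_nonneg_left hes hK10
      _ = K₁ / 2 * ((E + Y) * Y) := by rw [he2, hs2]; ring
  rw [hd] at hmain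
  calc gradNormSq (convect u u)
      ≤ 2 * ((3 : ℕ) * M ^ 2) * Y + 2 * (3 : ℕ) * ∫ x, (∑ m, ‖partialDeriv m u x‖ ^ 2) ^ 2 := hmain
    _ ≤ 2 * ((3 : ℕ) * M ^ 2) * Y + 2 * (3 : ℕ) * (K₁ / 2 * ((E + Y) * Y)) := by gcongr
    _ = (6 * K + 3 * K₁) * (E + Y) * Y := by rw [hM2]; push_cast; ring

end Torus

end Literature.Analysis.FunctionSpaces

end
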